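import Summits.Ventures.CertifiedManyBodySolver.Theorems.TcThermcert1GcClusterExpansion
import Mathlib
import HarnessLib

/-!
# The high-temperature two-fugacity cluster representation of the twisted torus trace (K2, part 11: the statement of the stub)

Helper file for route `TcThermcert1`, crux `ThermalStiffnessCeilingU8b10_le_1o8` (item `stmt-Ventures-26381`), line
`Cruxes/ThermalStiffnessCeilingU8b10_le_1o8/Lines/zerofree_corridor.lean`, registered stub K2 `stub_gcHighTempAnalytic`
(step S7 of `Cruxes/…/STUB-PLAN-stub_gcHighTempAnalytic.md`): the generic cluster expansion of part 10
(`TcThermcert1GcClusterExpansion.lean`, `twoFugacity_cluster`) specialised to the seam-twisted `t–t′` torus (`t = 1`, degree `8`,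
coupling `β c₁` with `|c₁(b)| ≤ 2 + 2|t′|`) and written against the explicit twisted grand-canonical trace of the stub:

* `gcHighTemp_constants`: the arithmetic `‖β‖ ≤ η₀(ε,t′,U) ⇒ ‖βU‖ ≤ 1/256, 192‖βU‖ ≤ ε/2` and the two smallness conditions;
* `gcHighTempAnalytic`: for real `t′, U`, every `ε > 0` has an `η₀ > 0` such that for `L ≥ 3`, real `θ`, complex `‖β‖ ≤ η₀` there is
  `h` analytic on the annulus pair with `‖h‖ ≤ ε` and
  `tr( diag(ζ↑^{N↑} ζ↓^{N↓}) e^{−βH^{tt′}_L(θ)} ) = (1+ζ↑)^{L²} (1+ζ↓)^{L²} e^{L² h(ζ)}` — literally the statement of the stub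
  (`h = log(z₂/((1+ζ↑)(1+ζ↓))) + L⁻² log Ξ(ρ)`, `η₀ = min(min(1/256, ε/384)/max(|U|,1), min(1/8450, a/64)/(e⁶10⁶(2+2|t′|)))`, `a = min(ε/2,1)`).

[cite: Ueltschi1999, Thm 2.1, Prop 2.2, §2.3; KoteckyPreiss1986, Theorem p. 492] High-temperature expansion only: nothing about
superconductivity in the Hubbard model is proved by anything in this file. No definitions; no `sorry`.
-/

noncomputable section

namespace Summit.Ventures.CertifiedManyBodySolver.Theorems.TcThermcert1.ZeroFreeCorridor

open Matrix Finset Complex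
open Literature.MathematicalPhysics.QuantumLattice Literature.Probability.LatticeModels
open Summit.HubbardSuperconductivity.HubbardLadder.Bounds

/-! ## §2 The twisted `t–t′` Hubbard torus: the statement of the stub -/

section Torus

/-- `|Λ_L| = L²`. -/
theorem card_fermionTorus_two (L : ℕ) [NeZero L] : Fintype.card (FermionTorus 2 L) = L ^ 2 := by simp

/-- The complex-`β` twisted coupling is bounded by `‖β‖ (2 + 2|t′|)` bond by bond. -/
theorem norm_smul_ttFluxCoupling_one_le (L : ℕ) [NeZero L] (hL : 3 ≤ L) (tp θ : ℝ) (β : ℂ)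
    (b : Bond (FermionTorus 2 L)) : ‖(β • ttFluxCoupling L 1 tp θ) b‖ ≤ ‖β‖ * (2 + 2 * |tp|) := by
  rw [Pi.smul_apply, smul_eq_mul, norm_mul]
  refine mul_le_mul_of_nonneg_left ?_ (norm_nonneg _)
  have := norm_ttFluxCoupling_le (L := L) hL 1 tp θ b
  simpa using this

/-- The arithmetic of the constants: `‖β‖ ≤ η₀(ε, t′, U)` gives `‖βU‖ ≤ 1/256`, `192‖βU‖ ≤ ε/2` and the two
Kotecký–Preiss smallness conditions for `Δ = 8`, `r₀ = 1000`, `s = ‖β‖(2+2|t′|)`, `a = min(ε/2,1)`. -/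
theorem gcHighTemp_constants (tp U : ℝ) {ε : ℝ} (hε : 0 < ε) {β : ℂ}
    (hβ : ‖β‖ ≤ min (min (1 / 256) (ε / 384) / max |U| 1)
      (min (1 / 8450) (min (ε / 2) 1 / 64) / (Real.exp 6 * 1000 ^ 2 * (2 + 2 * |tp|)))) :
    ‖β * (U : ℂ)‖ ≤ 1 / 256 ∧ 192 * ‖β * (U : ℂ)‖ ≤ ε / 2 ∧
      ((8 * 8 : ℕ) + 1 : ℝ) ^ 2 * (Real.exp 6 * 1000 ^ 2 * (‖β‖ * (2 + 2 * |tp|))) ≤ 1 / 2 ∧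
      8 * (8 : ℕ) * (Real.exp 6 * 1000 ^ 2 * (‖β‖ * (2 + 2 * |tp|))) ≤ min (ε / 2) 1 := by
  have hκpos : 0 < Real.exp 6 * 1000 ^ 2 := by positivity
  have htp : 0 < 2 + 2 * |tp| := by positivity
  have hmU : 0 < max |U| 1 := lt_max_of_lt_right one_pos
  have hβ1 : ‖β‖ ≤ min (1 / 256) (ε / 384) / max |U| 1 := hβ.trans (min_le_left _ _)
  have hβ2 : ‖β‖ ≤ min (1 / 8450) (min (ε / 2) 1 / 64) / (Real.exp 6 * 1000 ^ 2 * (2 + 2 * |tp|)) :=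
    hβ.trans (min_le_right _ _)
  have hβU' : ‖β * (U : ℂ)‖ ≤ min (1 / 256) (ε / 384) := by
    rw [norm_mul, Complex.norm_real, Real.norm_eq_abs]
    calc ‖β‖ * |U| ≤ min (1 / 256) (ε / 384) / max |U| 1 * max |U| 1 :=
          mul_le_mul hβ1 (le_max_left _ _) (abs_nonneg _) (by positivity)
      _ = min (1 / 256) (ε / 384) := div_mul_cancel₀ _ hmU.ne'
  have hsκ : Real.exp 6 * 1000 ^ 2 * (‖β‖ * (2 + 2 * |tp|)) ≤ min (1 / 8450) (min (ε / 2) 1 / 64) := by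
    calc Real.exp 6 * 1000 ^ 2 * (‖β‖ * (2 + 2 * |tp|))
        = ‖β‖ * (Real.exp 6 * 1000 ^ 2 * (2 + 2 * |tp|)) := by ring
      _ ≤ min (1 / 8450) (min (ε / 2) 1 / 64) / (Real.exp 6 * 1000 ^ 2 * (2 + 2 * |tp|)) *
            (Real.exp 6 * 1000 ^ 2 * (2 + 2 * |tp|)) := mul_le_mul_of_nonneg_right hβ2 (by positivity)
      _ = min (1 / 8450) (min (ε / 2) 1 / 64) := div_mul_cancel₀ _ (by positivity)
  have h3 := hsκ.trans (min_le_left _ _)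
  have h4 := hsκ.trans (min_le_right _ _)
  refine ⟨hβU'.trans (min_le_left _ _), ?_, ?_, ?_⟩
  · have := hβU'.trans (min_le_right _ _); linarith
  · push_cast; linarith
  · push_cast; linarith

/-- **K2 — the high-temperature two-fugacity cluster representation of the twisted grand-canonical torus trace.**
For real `t′, U` and `ε > 0` there is `η₀ > 0` such that for every `L ≥ 3`, real `θ` and complex `‖β‖ ≤ η₀` some `h`, analytic on the
annulus pair `2/3 < |ζσ| < 8/9` with `‖h‖ ≤ ε` there, satisfies
`tr( diag(ζ↑^{N↑(s)} ζ↓^{N↓(s)}) e^{−β H^{tt′}_L(θ)} ) = (1+ζ↑)^{L²} (1+ζ↓)^{L²} e^{L² h(ζ↑,ζ↓)}`.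
(`h = log(z₂/((1+ζ↑)(1+ζ↓))) + L⁻² log Ξ(ρ)` with `ρ` the pushforward site activity of the two-fugacity coupling polymer gas of
the twisted coupling `β c₁`, on the `t–t′` torus graph of degree `8`;
`η₀ = min( min(1/256, ε/384)/max(|U|,1), min(1/8450, a/64)/(e⁶10⁶(2+2|t′|)) )`, `a = min(ε/2,1)`.)
[cite: Ueltschi1999, Thm 2.1 and Prop 2.2; KoteckyPreiss1986, Theorem p. 492] -/
theorem gcHighTempAnalytic (tp U : ℝ) {ε : ℝ} (hε : 0 < ε) : ∃ η₀ : ℝ, 0 < η₀ ∧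
    ∀ (L : ℕ) [NeZero L], 3 ≤ L → ∀ θ : ℝ, ∀ β : ℂ, ‖β‖ ≤ η₀ →
      ∃ h : ℂ × ℂ → ℂ,
        AnalyticOnNhd ℂ h ({ζ : ℂ | 2 / 3 < ‖ζ‖ ∧ ‖ζ‖ < 8 / 9} ×ˢ {ζ : ℂ | 2 / 3 < ‖ζ‖ ∧ ‖ζ‖ < 8 / 9}) ∧
        (∀ ζ ∈ ({ζ : ℂ | 2 / 3 < ‖ζ‖ ∧ ‖ζ‖ < 8 / 9} ×ˢ {ζ : ℂ | 2 / 3 < ‖ζ‖ ∧ ‖ζ‖ < 8 / 9}), ‖h ζ‖ ≤ ε) ∧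
        ∀ ζ ∈ ({ζ : ℂ | 2 / 3 < ‖ζ‖ ∧ ‖ζ‖ < 8 / 9} ×ˢ {ζ : ℂ | 2 / 3 < ‖ζ‖ ∧ ‖ζ‖ < 8 / 9}),
          (diagonal (fun s : Finset (Orb (FermionTorus 2 L)) => ζ.1 ^ (upPart s).card * ζ.2 ^ (downPart s).card) *
              NormedSpace.exp (-β • hubbardTorusTT'Flux L tp U θ)).trace =
            (1 + ζ.1) ^ (L ^ 2) * (1 + ζ.2) ^ (L ^ 2) * cexp ((L : ℂ) ^ 2 * h ζ) := by
  have hκpos : 0 < Real.exp 6 * 1000 ^ 2 := by positivity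
  have ha : 0 < min (ε / 2) 1 := lt_min (by linarith) one_pos
  have ha1 : min (ε / 2) 1 ≤ 1 := min_le_right _ _
  have haε : min (ε / 2) 1 ≤ ε / 2 := min_le_left _ _
  have htp : 0 < 2 + 2 * |tp| := by positivity
  have hmU : 0 < max |U| 1 := lt_max_of_lt_right one_pos
  refine ⟨min (min (1 / 256) (ε / 384) / max |U| 1)
      (min (1 / 8450) (min (ε / 2) 1 / 64) / (Real.exp 6 * 1000 ^ 2 * (2 + 2 * |tp|))), by positivity, ?_⟩
  intro L _ hL θ β hβ
  obtain ⟨hβU, hβUε, hsmall, hsa⟩ := gcHighTemp_constants tp U hε hβ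
  have hs0 : 0 ≤ ‖β‖ * (2 + 2 * |tp|) := by positivity
  have hc : ∀ b, ‖(β • ttFluxCoupling L 1 tp θ) b‖ ≤ ‖β‖ * (2 + 2 * |tp|) :=
    norm_smul_ttFluxCoupling_one_le L hL tp θ β
  have hPc : ∀ b, (β • ttFluxCoupling L 1 tp θ) b ≠ 0 → b ∈ hubbardBonds (ttGraph L) := by
    intro b hb
    refine mem_hubbardBonds_ttGraph_of_ne_zero (L := L) hL (β := 1) (t' := tp) (θ := θ) fun hb0 => hb ?_
    rw [Pi.smul_apply, hb0, smul_zero]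
  have hLne : ((L : ℂ) ^ 2) ≠ 0 := pow_ne_zero _ (Nat.cast_ne_zero.2 (NeZero.ne L))
  have hL2 : (0 : ℝ) < (L : ℝ) ^ 2 := by
    have : (0 : ℝ) < L := Nat.cast_pos.2 (Nat.pos_of_ne_zero (NeZero.ne L))
    positivity
  -- the generic cluster representation on the `t–t′` torus graph (degree `8`), coupling `β c₁`
  obtain ⟨P, hPd, hPb, hrep⟩ := twoFugacity_cluster (G := ttGraph L) (Δ := 8) degree_ttGraph_le hβU hPc hs0 hc
    hsmall ha ha1 hsa
  have hU := isOpen_annulus_prod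
  refine ⟨fun ζ => Complex.log ((1 + ζ.1 + ζ.2 + ζ.1 * ζ.2 * cexp (-(β * (U : ℂ)))) / ((1 + ζ.1) * (1 + ζ.2))) +
      ((L : ℂ) ^ 2)⁻¹ * P ζ, ?_, ?_, ?_⟩
  · -- analyticity on the annulus pair
    exact (analyticOnNhd_log_zTwo_div (β := β) (U := (U : ℂ)) hβU).add
      (analyticOnNhd_const.mul (Literature.Analysis.Complex.SCV.analyticOnNhd_of_differentiableOn hPd hU))
  · -- the bound `‖h‖ ≤ 192‖βU‖ + a ≤ ε`
    intro ζ hζ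
    have h1 := norm_log_zTwo_div_le hζ hβU
    have h2 : ‖P ζ‖ ≤ min (ε / 2) 1 * (L : ℝ) ^ 2 := by
      have := hPb ζ hζ
      rwa [card_fermionTorus_two, Nat.cast_pow] at this
    have h3 : ‖((L : ℂ) ^ 2)⁻¹ * P ζ‖ ≤ min (ε / 2) 1 := by
      rw [norm_mul, norm_inv, norm_pow, Complex.norm_natCast]
      calc ((L : ℝ) ^ 2)⁻¹ * ‖P ζ‖
          ≤ ((L : ℝ) ^ 2)⁻¹ * (min (ε / 2) 1 * (L : ℝ) ^ 2) := mul_le_mul_of_nonneg_left h2 (by positivity)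
        _ = min (ε / 2) 1 := by field_simp
    exact (norm_add_le _ _).trans (by linarith)
  · -- the representation: fused exponent (part 0), the diagonal as `F_Λ` (part 1), instance transport, the generic formula
    intro ζ hζ
    obtain ⟨hζ1, hζ2⟩ := Set.mem_prod.mp hζ
    have hz := ne_zero_of_mem_annulus hζ1
    have hw := ne_zero_of_mem_annulus hζ2
    rw [gcTwist_trace_eq_trace_exp L hL tp U θ β hz hw, ← sum_logFugacity_univ_eq_diagonal]
    refine ((twoFugacity_trace_instIrrel β (U : ℂ) ζ.1 ζ.2 (β • ttFluxCoupling L 1 tp θ) _ _).trans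
      (hrep ζ hζ)).trans ?_
    rw [card_fermionTorus_two, zTwo_pow_eq_mul_cexp hζ hβU (L ^ 2), mul_assoc, ← Complex.exp_add, Nat.cast_pow]
    congr 2
    beta_reduce
    rw [mul_add ((L : ℂ) ^ 2), ← mul_assoc, mul_inv_cancel₀ hLne, one_mul]

end Torus

end Summit.Ventures.CertifiedManyBodySolver.Theorems.TcThermcert1.ZeroFreeCorridor
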